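import Mathlib
import Literature.NumberTheory.Transcendental.KZCubicalCalculus
import Literature.NumberTheory.Transcendental.KZSemialgebraicComplex
import Literature.NumberTheory.Transcendental.SemialgebraicLineDeriv
import Literature.ModelTheory.ExponentialFields.SemialgebraicInterior

/-!
# `TateLifting` (stmt-KontsevichZagierPeriods-9129), line `Sketch` — stub `stub_cylinderTame`

TAMENESS OF CYLINDER INTEGRANDS. For `P ∈ K[z₀,…,z_n]` and `q ∈ K[x]` with `q ≠ 0` on `[0,1]`,
where `K = algebraicClosure ℚ ℝ` is the field of real algebraic numbers, the cylinder integrand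
`z ↦ P(z) / q(z₀)` of the Kontsevich–Zagier calculus is

* real-analytic at every point of the closed unit cube `KZ.cube (n + 1) = [0,1]ⁿ⁺¹`, and
* a `ℚ`-semialgebraic function on it.

Both halves go through the substitution `q(z₀) = Q(z)` with `Q := q(X₀) ∈ K[z₀,…,z_n]`
(`Polynomial.aeval_algHom_apply`), after which numerator and denominator are evaluations of
multivariate polynomials over `K`: these are real-analytic everywhere (`analyticOnNhd_aeval`) and the
quotient is analytic off the zeros of the denominator (`AnalyticOnNhd.div`); and they are
`ℚ`-semialgebraic on the `ℚ`-semialgebraic cube (`Cylinder.isSemialgebraicFunOn_aeval`, by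
induction on the polynomial: real-algebraic constants are `ℚ`-definable
(`isSemialgebraicFunOn_const_of_isAlgebraic`, Kontsevich–Zagier 2001, §1.1: "rational" may be
replaced by "algebraic"), coordinates are polynomial over `ℚ`, and sums and products of real
semialgebraic functions are semialgebraic (Bochnak–Coste–Roy 1998, Prop. 2.2.6)), whence so is the
quotient (`IsSemialgebraicFunOn.div`).

References: M. Kontsevich, D. Zagier, *Periods* (2001), §1.1–§1.2; J. Bochnak, M. Coste,
M.-F. Roy, *Real Algebraic Geometry* (1998), §2.2.
-/

noncomputable section

open Set
open Literature.ModelTheory.ExponentialFields (IsSemialgebraic analyticOnNhd_aeval)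
open Literature.NumberTheory.Transcendental

namespace Summit.KontsevichZagierPeriods.InverseLandau

namespace Cylinder

/-- **Polynomials with real-algebraic coefficients are `ℚ`-semialgebraic functions on the closed
unit cube.** Induction on the polynomial: a constant `a ∈ K = ℚ̄ ∩ ℝ` is a `ℚ`-definable real
number, so the constant function `a` is `ℚ`-semialgebraic (`isSemialgebraicFunOn_const_of_isAlgebraic`);
coordinate functions are polynomial over `ℚ`; sums and products of real semialgebraic functions are
semialgebraic (Tarski–Seidenberg). [cite: KontsevichZagier2001, §1.1] -/
theorem isSemialgebraicFunOn_aeval (m : ℕ) (P : MvPolynomial (Fin m) (algebraicClosure ℚ ℝ)) :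
    IsSemialgebraicFunOn ℚ (KZ.cube m) (fun z : Fin m → ℝ => MvPolynomial.aeval z P) := by
  induction P using MvPolynomial.induction_on with
  | C a =>
    refine (isSemialgebraicFunOn_const_of_isAlgebraic KZ.isSemialgebraic_cube
      (mem_algebraicClosure_iff.1 a.2)).congr fun z _ => ?_
    simp
  | add p q hp hq =>
    refine (hp.fun_add hq).congr fun z _ => ?_
    simp
  | mul_X p i hp =>
    have hX : IsSemialgebraicFunOn ℚ (KZ.cube m) (fun z : Fin m → ℝ => z i) :=
      (Literature.NumberTheory.Transcendental.isSemialgebraicFunOn_aeval KZ.isSemialgebraic_cube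
        (MvPolynomial.X i : MvPolynomial (Fin m) ℚ)).congr fun z _ => by simp
    refine (hp.fun_mul hX).congr fun z _ => ?_
    simp

/-- The substitution `q(z₀) = Q(z)` with `Q := q(X₀) ∈ K[z₀,…,z_n]`: evaluating a one-variable
polynomial at the first coordinate is evaluating a multivariate polynomial. [folklore] -/
theorem polynomial_aeval_apply_zero (n : ℕ) (q : Polynomial (algebraicClosure ℚ ℝ))
    (z : Fin (n + 1) → ℝ) :
    Polynomial.aeval (z 0) q =
      MvPolynomial.aeval z
        (Polynomial.aeval (MvPolynomial.X 0 : MvPolynomial (Fin (n + 1)) (algebraicClosure ℚ ℝ)) q) := by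
  rw [← Polynomial.aeval_algHom_apply, MvPolynomial.aeval_X]

end Cylinder

/-- **Tameness of cylinder integrands** (stub `stub_cylinderTame` of crux `TateLifting`): for
`P ∈ K[z₀,…,z_n]`, `q ∈ K[x]` with `q ≠ 0` on `[0,1]` (`K = algebraicClosure ℚ ℝ`), the function
`z ↦ P(z)/q(z₀)` is real-analytic at every point of the closed cube `[0,1]ⁿ⁺¹`
(`analyticOnNhd_aeval`, `AnalyticOnNhd.div`) and `ℚ`-semialgebraic on it (real-algebraic
coefficients are `ℚ`-definable, Kontsevich–Zagier 2001, §1.1; closure of semialgebraic functions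
under `+`, `*`, `/`, Bochnak–Coste–Roy 1998, Prop. 2.2.6). [cite: KontsevichZagier2001, §1.2] -/
theorem tateLifting_cylinderTame :
    ∀ (n : ℕ) (P : MvPolynomial (Fin (n + 1)) (algebraicClosure ℚ ℝ))
      (q : Polynomial (algebraicClosure ℚ ℝ)),
      (∀ t ∈ Set.Icc (0 : ℝ) 1, Polynomial.aeval t q ≠ 0) →
      AnalyticOnNhd ℝ (fun z : Fin (n + 1) → ℝ => MvPolynomial.aeval z P / Polynomial.aeval (z 0) q)
          (KZ.cube (n + 1)) ∧
        IsSemialgebraicFunOn ℚ (KZ.cube (n + 1))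
          (fun z : Fin (n + 1) → ℝ => MvPolynomial.aeval z P / Polynomial.aeval (z 0) q) := by
  intro n P q hq
  -- the denominator as a multivariate polynomial over `K`
  set Q : MvPolynomial (Fin (n + 1)) (algebraicClosure ℚ ℝ) :=
    Polynomial.aeval (MvPolynomial.X 0 : MvPolynomial (Fin (n + 1)) (algebraicClosure ℚ ℝ)) q
    with hQdef
  have hQ : ∀ z : Fin (n + 1) → ℝ, Polynomial.aeval (z 0) q = MvPolynomial.aeval z Q :=
    Cylinder.polynomial_aeval_apply_zero n q
  have hQ0 : ∀ z ∈ KZ.cube (n + 1), MvPolynomial.aeval z Q ≠ 0 := fun z hz => by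
    rw [← hQ z]
    exact hq (z 0) ⟨(KZ.mem_cube.1 hz 0).1, (KZ.mem_cube.1 hz 0).2⟩
  have hfun : (fun z : Fin (n + 1) → ℝ => MvPolynomial.aeval z P / Polynomial.aeval (z 0) q) =
      fun z => MvPolynomial.aeval z P / MvPolynomial.aeval z Q :=
    funext fun z => by rw [hQ z]
  rw [hfun]
  exact ⟨((analyticOnNhd_aeval P).mono (subset_univ _)).div
      ((analyticOnNhd_aeval Q).mono (subset_univ _)) hQ0,
    (Cylinder.isSemialgebraicFunOn_aeval _ P).div (Cylinder.isSemialgebraicFunOn_aeval _ Q) hQ0⟩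

end Summit.KontsevichZagierPeriods.InverseLandau

end
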